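import Literature.Topology.FourManifolds.MorseEulerEqualities
import Literature.Topology.FourManifolds.RegularSlabCobordism
import Literature.Topology.FourManifolds.ClosedAsCobordism
import Literature.Topology.FourManifolds.MorseRelativeExistence
import HarnessLib

/-!
# The Morse count of a slab of a function which is Morse on the open slab

Topic `Literature/Topology/FourManifolds`; infrastructure for the Euler count
`card_eq_four_mul_of_sblf_of_homotopyEquiv_sphere_four` (Baykur 2012, Lemma 7) of
`SimplifiedBrokenLefschetzFibration.lean`, where a height function composed with a broken
Lefschetz fibration is Morse on a slab between two regular levels but NOT on the whole closed
manifold (it is constant to second order along the two pole fibres).  Everything here is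
**proved**; there are no definitions and no named facts.

* `finRelHomology_and_relEuler_slab_of_nondegenerate` — **the Morse equality on a slab**
  (Milnor 1965, §3 with Thm. 7.4 and Lemma 2.9): let `g` be a `C^∞` function on a closed
  `(n+1)`-manifold `X` (`n ≥ 1`), `a < b`, and suppose that `g` has no critical point with value in
  the bands `[a - δ, a]`, `[b, b + δ]` (`δ > 0`) and that its critical points with value in
  `(a, b)` are nondegenerate.  Then the homology of the slab `g⁻¹[a, b]` relative to its bottom
  `g⁻¹(a)` (coefficients `ℤ`) is finitely generated, vanishes from degree `n + 2` on, and
  `χ(g⁻¹[a, b], g⁻¹(a)) = Σ_{k ≤ n+1} (-1)^k #{critical points of index k with value in (a, b)}`.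

Proof: by the relative, `ε`-close existence theorem of Morse functions (Milnor 1965, Thm. 2.7
in the tree's form `exists_isMorse_eqOn_close`) `g` — read on the cobordism `(X; ∅, ∅)`
(`Cobordism.ofClosed`, the type synonym `HalfSpaceCharted X`) after an affine renormalisation
into `(0, 1)` — agrees on a neighbourhood of the slab with a Morse function `G` of the cobordism
all of whose values are `δ/3`-close to those of `g`; so `G⁻¹[a, b] = g⁻¹[a, b]` is a regular slab
of `G` (`Cobordism.IsRegularSlab`, Milnor's Lemma 2.9 as `RegularSlab.cobordism`) on which
`(G - a)/(b - a)` is a Morse function with the critical points and indices of `g`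
(`RegularSlab.isMorseFunction_fn`, `RegularSlab.criticalSetOfIndex_fn`), and the Morse equality
for cobordisms (`Cobordism.IsMorseFunction.relEuler_eq_sum_ncard`) applies.

## References

* J. Milnor, *Lectures on the h-cobordism theorem* (1965), Lemma 2.9, Thm. 2.7, §3 (PDF p. 21),
  Thm. 7.4. [MilnorHCobordism1965]
-/

noncomputable section

open scoped Manifold ContDiff Topology
open Set Function Filter
open Literature.AlgebraicTopology.SingularHomology

namespace Literature.Topology.FourManifolds

universe u

section Slab

variable {n : ℕ} {X : Type u} [TopologicalSpace X] [T2Space X] [SecondCountableTopology X]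
  [CompactSpace X] [ChartedSpace (EuclideanSpace ℝ (Fin (n + 1))) X] [IsManifold (𝓡 (n + 1)) ∞ X]

/-- **The Morse equality on a slab, normalised case** (values of `g` in `[1/4, 3/4]`,
`0 < a`, `b < 1`, see `finRelHomology_and_relEuler_slab_of_nondegenerate` for the statement and
the proof). [cite: MilnorHCobordism1965, §3 (PDF p. 21), Thm. 7.4, Thm. 2.7, Lemma 2.9] -/
theorem finRelHomology_and_relEuler_slab_of_nondegenerate_aux (hn : 1 ≤ n) {g : X → ℝ}
    (hg : ContMDiff (𝓡 (n + 1)) 𝓘(ℝ, ℝ) ∞ g) {a b δ : ℝ} (hab : a < b) (hδ : 0 < δ)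
    (ha : 0 < a) (hb : b < 1) (hval : ∀ x, g x ∈ Icc (1 / 4 : ℝ) (3 / 4))
    (hreg : ∀ x, g x ∈ Icc (a - δ) a ∪ Icc b (b + δ) → ¬ IsMCriticalPt (𝓡 (n + 1)) g x)
    (hnd : ∀ x, g x ∈ Ioo a b → IsMCriticalPt (𝓡 (n + 1)) g x →
      (mhessian (𝓡 (n + 1)) g x).Nondegenerate) :
    FinRelHomology ℤ ℤ ↥(g ⁻¹' Icc a b) (Subtype.val ⁻¹' (g ⁻¹' {a})) (n + 2) ∧
      relEuler ℤ ℤ ↥(g ⁻¹' Icc a b) (Subtype.val ⁻¹' (g ⁻¹' {a})) =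
        ∑ k ∈ Finset.range (n + 2), (-1 : ℤ) ^ k *
          ((criticalSetOfIndex (𝓡 (n + 1)) g k ∩ g ⁻¹' Ioo a b).ncard : ℤ) := by
  -- read `g` on the total space `W = HalfSpaceCharted X` of the cobordism `(X; ∅, ∅)`
  set G₀ : (Cobordism.ofClosed n X).W → ℝ := g ∘ HalfSpaceCharted.of.symm with hG₀
  have hG₀s : ContMDiff (𝓡∂ (n + 1)) 𝓘(ℝ, ℝ) ∞ G₀ :=
    (HalfSpaceCharted.contMDiff_iff (n := n) (f := g)).2 hg
  have hG₀c : Continuous G₀ := hG₀s.continuous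
  have hcrit₀ : ∀ x : (Cobordism.ofClosed n X).W, IsMCriticalPt (𝓡∂ (n + 1)) G₀ x →
      IsMCriticalPt (𝓡 (n + 1)) g (HalfSpaceCharted.of.symm x) := fun x hx =>
    (HalfSpaceCharted.isMCriticalPt_iff' (n := n) (f := g) (q := x)).1 hx
  have hcrit₀' : ∀ x : (Cobordism.ofClosed n X).W, IsMCriticalPt (𝓡 (n + 1)) g (HalfSpaceCharted.of.symm x) →
      IsMCriticalPt (𝓡∂ (n + 1)) G₀ x := fun x hx =>
    (HalfSpaceCharted.isMCriticalPt_iff' (n := n) (f := g) (q := x)).2 hx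
  have hval₀ : ∀ x : (Cobordism.ofClosed n X).W, G₀ x ∈ Icc (1 / 4 : ℝ) (3 / 4) := fun x =>
    hval (HalfSpaceCharted.of.symm x)
  have hreg₀' : ∀ x : (Cobordism.ofClosed n X).W, IsMCriticalPt (𝓡∂ (n + 1)) G₀ x →
      a - δ ≤ G₀ x → G₀ x ≤ b + δ → G₀ x ∈ Ioo a b := by
    intro x hx h1 h2
    have hnot : G₀ x ∉ Icc (a - δ) a ∪ Icc b (b + δ) := fun h => hreg (HalfSpaceCharted.of.symm x) h (hcrit₀ x hx)
    simp only [mem_union, mem_Icc, not_or, not_and_or, not_le] at hnot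
    constructor
    · rcases hnot.1 with h | h
      · linarith
      · exact h
    · rcases hnot.2 with h | h
      · exact h
      · linarith
  have hnd₀' : ∀ x : (Cobordism.ofClosed n X).W, G₀ x ∈ Ioo a b →
      IsMCriticalPt (𝓡∂ (n + 1)) G₀ x → (mhessian (𝓡∂ (n + 1)) G₀ x).Nondegenerate := by
    intro x hx hc
    have hc' : IsMCriticalPt (𝓡 (n + 1)) g (HalfSpaceCharted.of.symm x) := hcrit₀ x hc
    have h2 : ContMDiffAt (𝓡 (n + 1)) 𝓘(ℝ, ℝ) 2 g (HalfSpaceCharted.of.symm x) := (hg _).of_le (by norm_cast)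
    exact (HalfSpaceCharted.nondegenerate_mhessian_iff (f := g) (p := HalfSpaceCharted.of.symm x) h2 hc').2 (hnd _ hx hc')
  -- the neighbourhoods of the slab
  set η : ℝ := δ / 3 with hη
  have hη0 : 0 < η := by positivity
  set V₁ : Set (Cobordism.ofClosed n X).W := G₀ ⁻¹' Ioo (a - 2 * η) (b + 2 * η) with hV₁
  set V₂ : Set (Cobordism.ofClosed n X).W := G₀ ⁻¹' Ioo (a - 3 * η) (b + 3 * η) with hV₂
  have hV₁o : IsOpen V₁ := isOpen_Ioo.preimage hG₀c
  have hV₂o : IsOpen V₂ := isOpen_Ioo.preimage hG₀c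
  have hcl₁ : closure V₁ ⊆ G₀ ⁻¹' Icc (a - 2 * η) (b + 2 * η) := by
    rw [hV₁, ← closure_Ioo (by linarith)]
    exact hG₀c.closure_preimage_subset _
  have hcl₂ : closure V₂ ⊆ G₀ ⁻¹' Icc (a - 3 * η) (b + 3 * η) := by
    rw [hV₂, ← closure_Ioo (by linarith)]
    exact hG₀c.closure_preimage_subset _
  have h12 : closure V₁ ⊆ V₂ := fun x hx => by
    have h := hcl₁ hx
    simp only [mem_preimage, mem_Icc] at h
    exact ⟨by linarith [h.1], by linarith [h.2]⟩
  have hbd : (𝓡∂ (n + 1)).boundary (Cobordism.ofClosed n X).W ⊆ V₁ := by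
    intro z hz
    have hz' : z ∈ (𝓡∂ (n + 1)).boundary (HalfSpaceCharted X) := hz
    rw [HalfSpaceCharted.boundary_eq_empty] at hz'
    exact hz'.elim
  have hreg₀ : ∀ x ∈ closure V₂, x ∉ V₁ → ¬ IsMCriticalPt (𝓡∂ (n + 1)) G₀ x := by
    intro x hx hx1 hc
    have h2 := hcl₂ hx
    simp only [mem_preimage, mem_Icc] at h2
    have h3 := hreg₀' x hc (by linarith [h2.1]) (by linarith [h2.2])
    simp only [hV₁, mem_preimage, mem_Ioo, not_and_or, not_lt] at hx1
    rcases hx1 with h | h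
    · linarith [h3.1]
    · linarith [h3.2]
  have hnd₀ : ∀ x ∈ V₁, IsMCriticalPt (𝓡∂ (n + 1)) G₀ x →
      (mhessian (𝓡∂ (n + 1)) G₀ x).Nondegenerate := by
    intro x hx hc
    simp only [hV₁, mem_preimage, mem_Ioo] at hx
    exact hnd₀' x (hreg₀' x hc (by linarith [hx.1]) (by linarith [hx.2])) hc
  have hlt₀ : ∀ x, (𝓡∂ (n + 1)).IsInteriorPoint x → G₀ x < 1 := fun x _ => by
    linarith [(hval₀ x).2]
  -- the Morse perturbation, frozen near the slab and `ε`-close (Milnor's Thm. 2.7, relative form)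
  set ε : ℝ := min η (1 / 8) with hε
  have hε0 : 0 < ε := by positivity
  have hεη : ε ≤ η := min_le_left _ _
  have hε8 : ε ≤ 1 / 8 := min_le_right _ _
  obtain ⟨G, hGM, hGeq, hGcrit, -, hclose⟩ :=
    exists_isMorse_eqOn_close hG₀s hlt₀ hV₁o hV₂o h12 hbd hreg₀ hnd₀ hε0
  have hclose' : ∀ x, G₀ x - ε < G x ∧ G x < G₀ x + ε := fun x => by
    have h1 := hclose x
    rw [abs_lt] at h1
    constructor <;> linarith [h1.1, h1.2]
  -- values of `G`
  have hGval : ∀ x, G x ∈ Ioo (0 : ℝ) 1 := fun x => by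
    have h1 := hclose' x
    have h2 := hval₀ x
    constructor <;> linarith [h2.1, h2.2, h1.1, h1.2]
  -- `G` and `G₀` have the same slab and agree on it
  have hGeq' : ∀ x, G₀ x ∈ Icc a b → G x = G₀ x := fun x hx =>
    hGeq x (subset_closure (show x ∈ V₁ from ⟨by linarith [hx.1], by linarith [hx.2]⟩))
  have hslab : ∀ x, G x ∈ Icc a b ↔ G₀ x ∈ Icc a b := by
    intro x
    constructor
    · intro hx
      by_cases hxV : x ∈ closure V₁
      · rw [← hGeq x hxV]; exact hx
      · exfalso
        have hxV' : x ∉ V₁ := fun h => hxV (subset_closure h)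
        simp only [hV₁, mem_preimage, mem_Ioo, not_and_or, not_lt] at hxV'
        have h1 := hclose' x
        rcases hxV' with h | h <;> linarith [hx.1, hx.2]
    · intro hx
      rw [hGeq' x hx]; exact hx
  have hslab_eq : G ⁻¹' Icc a b = G₀ ⁻¹' Icc a b := Set.ext hslab
  -- near a point of the slab `G = G₀ (+ 0)`
  have hgerm : ∀ x, G₀ x ∈ Icc a b → G =ᶠ[𝓝 x] fun y => G₀ y + 0 := by
    intro x hx
    have hxV : x ∈ V₁ := ⟨by linarith [hx.1], by linarith [hx.2]⟩
    filter_upwards [hV₁o.mem_nhds hxV] with y hy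
    rw [add_zero]; exact hGeq y (subset_closure hy)
  -- `G` is a Morse function of the cobordism `(X; ∅, ∅)` …
  have hF : (Cobordism.ofClosed n X).IsMorseFunction G :=
    ⟨hGM, fun x => x.elim, fun y => y.elim, fun z hz _ => by
      have hz' : z ∈ (𝓡∂ (n + 1)).boundary (HalfSpaceCharted X) := hz
      rw [HalfSpaceCharted.boundary_eq_empty] at hz'
      exact hz'.elim, fun z _ => hGval z⟩
  -- … whose levels `a`, `b` are not critical
  have hcritval : ∀ z ∈ criticalSet (𝓡∂ (n + 1)) G, G z ≠ a ∧ G z ≠ b := by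
    intro z hz
    rcases hGcrit z (mem_criticalSet.1 hz) with ⟨hzV, hzc⟩ | hzV
    · rw [hGeq z (subset_closure hzV)]
      simp only [hV₁, mem_preimage, mem_Ioo] at hzV
      have h3 := hreg₀' z hzc (by linarith [hzV.1]) (by linarith [hzV.2])
      exact ⟨h3.1.ne', h3.2.ne⟩
    · have hzV' : z ∉ V₂ := fun h => hzV (subset_closure h)
      simp only [hV₂, mem_preimage, mem_Ioo, not_and_or, not_lt] at hzV'
      have h1 := hclose' z
      constructor <;> intro h <;> rcases hzV' with h' | h' <;> linarith
  have hS : (Cobordism.ofClosed n X).IsRegularSlab G a b :=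
    { isMorseFunction := hF
      pos := ha
      lt := hab
      lt_one := hb
      ne_left := fun z hz => (hcritval z hz).1
      ne_right := fun z hz => (hcritval z hz).2 }
  -- the Morse equality for the cobordism `(G⁻¹[a, b]; G⁻¹(a), G⁻¹(b))` (Lemma 2.9, §3, Thm. 7.4)
  have hfn := RegularSlab.isMorseFunction_fn hS hn
  have hfinW : FinRelHomology ℤ ℤ (RegularSlab hS) (range (RegularSlab.cobordism hS).inl) (n + 2) :=
    (hfn.finRelHomology ℤ ℤ).1
  have hχW : relEuler ℤ ℤ (RegularSlab hS) (range (RegularSlab.cobordism hS).inl) =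
      (∑ k ∈ Finset.range (n + 2),
        (-1 : ℤ) ^ k * ((criticalSetOfIndex (𝓡∂ (n + 1)) (RegularSlab.fn hS) k).ncard : ℤ)) *
          Module.finrank ℤ ℤ :=
    hfn.relEuler_eq_sum_ncard ℤ ℤ
  rw [Module.finrank_self, Nat.cast_one, mul_one] at hχW
  -- transfer to the slab of `g` in `X` along the identity homeomorphism
  have hset : (G ⁻¹' Icc a b : Set (Cobordism.ofClosed n X).W) = (g ⁻¹' Icc a b : Set X) := by
    rw [hslab_eq]; rfl
  let e : RegularSlab hS ≃ₜ ↥(g ⁻¹' Icc a b) := Homeomorph.setCongr hset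
  have hrange := RegularSlab.range_cobordism_inl hS
  have hto : MapsTo e (range (RegularSlab.cobordism hS).inl) (Subtype.val ⁻¹' (g ⁻¹' {a})) := by
    intro p hp
    have hp' : G (RegularSlab.incl hS p) = a := (Set.ext_iff.1 hrange p).1 hp
    have hp2 : G₀ (RegularSlab.incl hS p) ∈ Icc a b := (hslab _).1 (RegularSlab.apply_incl_mem hS p)
    rw [hGeq' _ hp2] at hp'
    exact hp'
  have hfrom : MapsTo e.symm (Subtype.val ⁻¹' (g ⁻¹' {a}))
      (range (RegularSlab.cobordism hS).inl) := by
    intro q hq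
    refine (Set.ext_iff.1 hrange (e.symm q)).2 ?_
    have hq' : g (q : X) = a := hq
    have hq2 : G₀ (RegularSlab.incl hS (e.symm q)) ∈ Icc a b := by
      show g q ∈ Icc a b
      exact q.2
    show G (RegularSlab.incl hS (e.symm q)) = a
    rw [hGeq' _ hq2]
    exact hq'
  refine ⟨hfinW.of_homeomorph e hto hfrom, ?_⟩
  rw [← relEuler_eq_of_homeomorph e hto hfrom, hχW]
  refine Finset.sum_congr rfl fun k _ => ?_
  congr 2
  -- count the critical points of index `k` with value in `[a, b]`
  rw [RegularSlab.criticalSetOfIndex_fn hS hn k]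
  have hpre : (RegularSlab.incl hS ⁻¹' criticalSetOfIndex (𝓡∂ (n + 1)) G k).ncard =
      (criticalSetOfIndex (𝓡∂ (n + 1)) G k ∩ G ⁻¹' Icc a b).ncard := by
    rw [← RegularSlab.range_incl hS, ← Set.ncard_preimage_of_injective_subset_range
      (RegularSlab.injective_incl hS) inter_subset_right, Set.preimage_inter_range]
  rw [hpre]
  -- on the slab `G = G₀` near every point
  have hcount : criticalSetOfIndex (𝓡∂ (n + 1)) G k ∩ G ⁻¹' Icc a b =
      criticalSetOfIndex (𝓡∂ (n + 1)) G₀ k ∩ G₀ ⁻¹' Ioo a b := by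
    ext z
    simp only [mem_inter_iff, mem_criticalSetOfIndex, mem_preimage]
    constructor
    · rintro ⟨⟨hc, hk⟩, hz⟩
      have hz0 : G₀ z ∈ Icc a b := (hslab z).1 hz
      have hc0 : IsMCriticalPt (𝓡∂ (n + 1)) G₀ z :=
        (isMCriticalPt_congr_of_eventuallyEq_add_const (hgerm z hz0)).1 hc
      refine ⟨⟨hc0, ?_⟩, hreg₀' z hc0 (by linarith [hz0.1]) (by linarith [hz0.2])⟩
      unfold morseIndex at hk ⊢
      rw [← mhessian_congr_of_eventuallyEq_add_const (hgerm z hz0)]; exact hk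
    · rintro ⟨⟨hc, hk⟩, hz⟩
      have hz0 : G₀ z ∈ Icc a b := Ioo_subset_Icc_self hz
      refine ⟨⟨(isMCriticalPt_congr_of_eventuallyEq_add_const (hgerm z hz0)).2 hc, ?_⟩,
        (hslab z).2 hz0⟩
      unfold morseIndex at hk ⊢
      rw [mhessian_congr_of_eventuallyEq_add_const (hgerm z hz0)]; exact hk
  rw [hcount]
  -- and `G₀` is `g`
  show (criticalSetOfIndex (𝓡∂ (n + 1)) (M := HalfSpaceCharted X) (g ∘ HalfSpaceCharted.of.symm) k ∩
    (g ∘ HalfSpaceCharted.of.symm) ⁻¹' Ioo a b).ncard = _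
  rw [HalfSpaceCharted.criticalSetOfIndex_eq (hg.of_le (by norm_cast)) k]
  rfl

/-- `α s + β ≤ α t + β ↔ s ≤ t` for `α > 0`. [folklore] -/
private theorem affine_le_affine_iff {α β s t : ℝ} (hα : 0 < α) :
    α * s + β ≤ α * t + β ↔ s ≤ t := by
  constructor
  · intro h
    by_contra h'
    have := mul_lt_mul_of_pos_left (not_le.1 h') hα
    linarith
  · intro h
    have := mul_le_mul_of_nonneg_left h hα.le
    linarith

/-- `α s + β < α t + β ↔ s < t` for `α > 0`. [folklore] -/
private theorem affine_lt_affine_iff {α β s t : ℝ} (hα : 0 < α) :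
    α * s + β < α * t + β ↔ s < t := by
  rw [← not_le, affine_le_affine_iff hα, not_le]

/-- `α s + β = α t + β ↔ s = t` for `α > 0`. [folklore] -/
private theorem affine_eq_affine_iff {α β s t : ℝ} (hα : 0 < α) :
    α * s + β = α * t + β ↔ s = t := by
  rw [le_antisymm_iff, le_antisymm_iff, affine_le_affine_iff hα, affine_le_affine_iff hα]

/-- **The Morse equality on a slab** (Milnor 1965, §3 with Thm. 7.4, read on the sub-cobordism
`(g⁻¹[a, b]; g⁻¹(a), g⁻¹(b))` of Lemma 2.9 after the relative Morse approximation of Thm. 2.7).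
Let `g` be a `C^∞` function on a closed `(n+1)`-manifold `X` (`n ≥ 1`) and `a < b`; suppose that
no critical point of `g` has its value in `[a - δ, a] ∪ [b, b + δ]` (`δ > 0`) and that the critical
points with value in `(a, b)` are nondegenerate.  Then `H_k(g⁻¹[a, b], g⁻¹(a); ℤ)` is finitely
generated for all `k` and zero for `k ≥ n + 2`, and
`χ(g⁻¹[a, b], g⁻¹(a)) = Σ_{k ≤ n+1} (-1)^k · #{critical points of index k with value in (a, b)}`.
No hypothesis is made on `g` away from `g⁻¹[a - δ, b + δ]`.
[cite: MilnorHCobordism1965, §3 (PDF p. 21), Thm. 7.4, Thm. 2.7, Lemma 2.9] -/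
theorem finRelHomology_and_relEuler_slab_of_nondegenerate (hn : 1 ≤ n) {g : X → ℝ}
    (hg : ContMDiff (𝓡 (n + 1)) 𝓘(ℝ, ℝ) ∞ g) {a b δ : ℝ} (hab : a < b) (hδ : 0 < δ)
    (hreg : ∀ x, g x ∈ Icc (a - δ) a ∪ Icc b (b + δ) → ¬ IsMCriticalPt (𝓡 (n + 1)) g x)
    (hnd : ∀ x, g x ∈ Ioo a b → IsMCriticalPt (𝓡 (n + 1)) g x →
      (mhessian (𝓡 (n + 1)) g x).Nondegenerate) :
    FinRelHomology ℤ ℤ ↥(g ⁻¹' Icc a b) (Subtype.val ⁻¹' (g ⁻¹' {a})) (n + 2) ∧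
      relEuler ℤ ℤ ↥(g ⁻¹' Icc a b) (Subtype.val ⁻¹' (g ⁻¹' {a})) =
        ∑ k ∈ Finset.range (n + 2), (-1 : ℤ) ^ k *
          ((criticalSetOfIndex (𝓡 (n + 1)) g k ∩ g ⁻¹' Ioo a b).ncard : ℤ) := by
  -- an affine renormalisation `α g + β` with values, levels and bands inside `[1/4, 3/4]`
  obtain ⟨lo, hi, hlohi, hlo, hhi, hloa, hbhi⟩ : ∃ lo hi : ℝ, lo < hi ∧ (∀ x, lo ≤ g x) ∧
      (∀ x, g x ≤ hi) ∧ lo ≤ a - δ ∧ b + δ ≤ hi := by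
    obtain ⟨M, hM⟩ := (isCompact_range hg.continuous).isBounded.bddAbove
    obtain ⟨m, hm⟩ := (isCompact_range hg.continuous).isBounded.bddBelow
    refine ⟨min m (a - δ), max M (b + δ), ?_, fun x => (min_le_left _ _).trans (hm ⟨x, rfl⟩),
      fun x => (hM ⟨x, rfl⟩).trans (le_max_left _ _), min_le_right _ _, le_max_right _ _⟩
    exact (min_le_right _ _).trans_lt ((by linarith : a - δ < b + δ).trans_le (le_max_right _ _))
  have hpos : 0 < hi - lo := sub_pos.2 hlohi
  set α : ℝ := 1 / (2 * (hi - lo)) with hα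
  have hα0 : 0 < α := by positivity
  set β : ℝ := 1 / 4 - α * lo with hβ
  have hval' : ∀ t, lo ≤ t → t ≤ hi → α * t + β ∈ Icc (1 / 4 : ℝ) (3 / 4) := by
    intro t h1 h2
    have e1 : α * t + β = 1 / 4 + (t - lo) / (2 * (hi - lo)) := by
      rw [hβ, hα]; ring
    rw [e1, mem_Icc]
    constructor
    · have : 0 ≤ (t - lo) / (2 * (hi - lo)) := div_nonneg (by linarith) (by linarith)
      linarith
    · have : (t - lo) / (2 * (hi - lo)) ≤ 1 / 2 := by
        rw [div_le_iff₀ (by linarith)]; linarith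
      linarith
  have hg₁ : ContMDiff (𝓡 (n + 1)) 𝓘(ℝ, ℝ) ∞ fun x => α * g x + β :=
    ((contDiff_const.mul contDiff_id).add contDiff_const).comp_contMDiff hg
  have hd : ∀ x, MDifferentiableAt (𝓡 (n + 1)) 𝓘(ℝ, ℝ) g x := fun x =>
    hg.mdifferentiableAt (by simp)
  have ha' : 0 < α * a + β := by
    have h := (hval' (a - δ) hloa (by linarith)).1
    have : α * (a - δ) + β < α * a + β := (affine_lt_affine_iff hα0).2 (by linarith)
    linarith
  have hb' : α * b + β < 1 := by
    have h := (hval' (b + δ) (by linarith) hbhi).2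
    have : α * b + β < α * (b + δ) + β := (affine_lt_affine_iff hα0).2 (by linarith)
    linarith
  have hab' : α * a + β < α * b + β := (affine_lt_affine_iff hα0).2 hab
  have hδ' : 0 < α * δ := mul_pos hα0 hδ
  -- the hypotheses transform
  have key := finRelHomology_and_relEuler_slab_of_nondegenerate_aux (g := fun x => α * g x + β)
    hn hg₁ hab' hδ' ha' hb' (fun x => hval' (g x) (hlo x) (hhi x))
    (fun x hx => by
      rw [isMCriticalPt_const_mul_add_iff hα0.ne' β (hd x)]
      apply hreg
      simp only [mem_union, mem_Icc] at hx ⊢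
      rcases hx with ⟨h1, h2⟩ | ⟨h1, h2⟩
      · left
        exact ⟨(affine_le_affine_iff hα0).1 (by linarith), (affine_le_affine_iff hα0).1 h2⟩
      · right
        exact ⟨(affine_le_affine_iff hα0).1 h1, (affine_le_affine_iff hα0).1 (by linarith)⟩)
    (fun x hx hc => by
      rw [isMCriticalPt_const_mul_add_iff hα0.ne' β (hd x)] at hc
      have hx' : g x ∈ Ioo a b :=
        ⟨(affine_lt_affine_iff hα0).1 hx.1, (affine_lt_affine_iff hα0).1 hx.2⟩
      rw [mhessian_const_mul_add g hα0.ne' β]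
      obtain ⟨hl, hr⟩ := hnd x hx' hc
      refine ⟨fun v hv => hl v fun w => ?_, fun v hv => hr v fun w => ?_⟩
      · have h := hv w
        simp only [LinearMap.smul_apply, smul_eq_mul, mul_eq_zero, hα0.ne', false_or] at h
        exact h
      · have h := hv w
        simp only [LinearMap.smul_apply, smul_eq_mul, mul_eq_zero, hα0.ne', false_or] at h
        exact h)
  -- and so do the conclusions
  have h1 : (fun x => α * g x + β) ⁻¹' Icc (α * a + β) (α * b + β) = g ⁻¹' Icc a b := by
    ext x
    simp only [mem_preimage, mem_Icc, affine_le_affine_iff hα0]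
  have h2 : (fun x => α * g x + β) ⁻¹' {α * a + β} = g ⁻¹' {a} := by
    ext x
    simp only [mem_preimage, mem_singleton_iff, affine_eq_affine_iff hα0]
  have h3 : ∀ k, criticalSetOfIndex (𝓡 (n + 1)) (fun x => α * g x + β) k ∩
      (fun x => α * g x + β) ⁻¹' Ioo (α * a + β) (α * b + β) =
      criticalSetOfIndex (𝓡 (n + 1)) g k ∩ g ⁻¹' Ioo a b := by
    intro k
    ext x
    simp only [mem_inter_iff, mem_criticalSetOfIndex, mem_preimage, mem_Ioo,
      affine_lt_affine_iff hα0, isMCriticalPt_const_mul_add_iff hα0.ne' β (hd x),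
      morseIndex_const_mul_add g hα0 β x]
  rw [h1, h2] at key
  exact ⟨key.1, key.2.trans (Finset.sum_congr rfl fun k _ => by rw [h3 k])⟩

end Slab

end Literature.Topology.FourManifolds
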